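import Mathlib
import Summits.Parity.BatemanHorn.Theorems.IsogenyRedeiSplitBlockJacobiSmoothCutoff
import Summits.Parity.BatemanHorn.Theorems.IsogenyRedeiSplitBlockJacobiCell
import Summits.Parity.BatemanHorn.Theorems.IsogenyRedeiSplitBlockJacobiCells
import Summits.Parity.BatemanHorn.Theorems.IsogenyRedeiSplitBlockJacobiPoissonBulk
import HarnessLib

/-!
# The uniform bound for a good cell (helper toward `stub_poissonReduction`, line
`cofactor-root-discrepancy`, crux `SplitBlockJacobi`, stmt-Parity-11583)

`good_cell_bound`: for a good cell `(g_i, g_{i+1}] × (g_j, g_{j+1}]`, `i ≤ j`, of a dyadic grid with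
`g_0 = ⌊x^θ⌋`, `g_0² ≥ x`, the tier Weyl bound AT `x` (hypothesis) and the frequency cutoff
`H = ⌊4 g_i g_j x^{ε₀/8 - 1}⌋` turn `cell_bound` into the uniform estimate
`48672 · x^{1 − ε₀ + 3ε₀/8} + 4 X (x^{1 − ε₀/8})^{k+1} / L^k`.
-/

noncomputable section

open Finset

namespace Summit.Parity.BatemanHorn.Cruxes.SplitBlockJacobi.CofactorRootDiscrepancy.Poisson

/-- The cutoff polynomial `(Σ_{M < s ≤ N} X^s) · (Σ_{j < L} X^j)^k ∈ ℕ[X]` (local notation). -/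
local notation3 "cutoffPoly[" M ", " N ", " L ", " k "]" =>
  ((∑ s ∈ Finset.Ioc M N, (Polynomial.X : Polynomial ℕ) ^ s) *
    (∑ j ∈ Finset.range L, (Polynomial.X : Polynomial ℕ) ^ j) ^ k)

/-- The root Weyl sum `S(h, q)` (local notation; literally the skeleton's `rootWeylSum h q`). -/
local notation3 (prettyPrint := false) "rWS[" h "](" q ")" =>
  (∑ ν ∈ (Finset.range (q : ℕ)).filter (fun ν : ℕ => (q : ℕ) ∣ ν ^ 2 + 1),
    Complex.exp (2 * Real.pi * Complex.I * ((h : ℤ) : ℂ) * ((ν : ℕ) : ℂ) / ((q : ℕ) : ℂ)))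

/-- The twisted root Weyl sum over `(a, m] × (b, n]` (local notation; literally the skeleton's
`twistedSum h a m b n`). -/
local notation3 (prettyPrint := false) "tS[" h "](" a ", " m ", " b ", " n ")" =>
  (∑ Q ∈ (Finset.Ioc (a : ℕ) m).filter (fun Q : ℕ => Q.Prime ∧ Q % 4 = 1),
    ∑ Q' ∈ (Finset.Ioc (b : ℕ) n).filter (fun Q' : ℕ => Q'.Prime ∧ Q' % 4 = 1),
      ((jacobiSym (Q : ℤ) Q' : ℤ) : ℂ) * rWS[h](Q * Q'))

/-! ### Real-power bookkeeping -/

/-- `x^{a} · x^{b} = x^{a+b}` for `x > 0` (restated for rewriting right to left). -/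
theorem rpow_add_rev {x : ℝ} (hx : 0 < x) (a b : ℝ) : x ^ a * x ^ b = x ^ (a + b) :=
  (Real.rpow_add hx a b).symm

/-- `x · x^{c−1} = x^c` for `x > 0`. -/
theorem mul_rpow_sub_one {x : ℝ} (hx : 0 < x) (c : ℝ) : x * x ^ (c - 1) = x ^ c := by
  rw [Real.rpow_sub_one hx.ne']
  field_simp

/-! ### The weight is bounded by one -/

/-- `0 ≤ w ≤ 1` and `W = Σ_{t ≤ x} w(t) ≤ x` for `w = c_k/L^k`. -/
theorem sum_cutoff_weight_le (M N L k x : ℕ) (hL : 0 < L) :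
    (∀ t, 0 ≤ (((cutoffPoly[M, N, L, k]).coeff t : ℕ) : ℝ) / (L : ℝ) ^ k) ∧
    (∀ t, (((cutoffPoly[M, N, L, k]).coeff t : ℕ) : ℝ) / (L : ℝ) ^ k ≤ 1) ∧
    ∑ t ∈ Finset.Icc 1 x, (((cutoffPoly[M, N, L, k]).coeff t : ℕ) : ℝ) / (L : ℝ) ^ k ≤ x := by
  have hLk : (0 : ℝ) < (L : ℝ) ^ k := by positivity
  have h1 : ∀ t, (((cutoffPoly[M, N, L, k]).coeff t : ℕ) : ℝ) / (L : ℝ) ^ k ≤ 1 := by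
    intro t
    rw [div_le_one hLk]
    exact_mod_cast coeff_cutoff_le M N L k t hL
  refine ⟨fun t => by positivity, h1, ?_⟩
  calc ∑ t ∈ Finset.Icc 1 x, (((cutoffPoly[M, N, L, k]).coeff t : ℕ) : ℝ) / (L : ℝ) ^ k
      ≤ ∑ t ∈ Finset.Icc 1 x, (1 : ℝ) := Finset.sum_le_sum fun t _ => h1 t
    _ = x := by simp

/-! ### The uniform bound for a good cell -/

set_option maxHeartbeats 400000 in
/-- **Uniform bound for a good cell** `(g_i, g_{i+1}] × (g_j, g_{j+1}]`, `i ≤ j`,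
`g_{i+1} g_{j+1} ≤ X = x^{2−μ}`: see the module docstring. The tier Weyl bound at `x` is the
hypothesis `hTWx`. -/
theorem good_cell_bound (θ μ ε₀ : ℝ) (x M N L k : ℕ) (hε₀ : 0 < ε₀)
    (hL : 0 < L) (hxw : N + k * (L - 1) ≤ x) (hx0 : 1 ≤ x)
    (hx1 : (16 : ℝ) ≤ (x : ℝ) ^ (1 - ε₀ / 8)) (hx2 : (4 : ℝ) ≤ (x : ℝ) ^ (ε₀ - ε₀ / 8))
    (hxθ : (2 : ℝ) ≤ (x : ℝ) ^ θ)
    {g : ℕ → ℕ} (hg : Monotone g) (hg0 : g 0 = ⌊(x : ℝ) ^ θ⌋₊) (hg2 : ∀ i, g (i + 1) ≤ 2 * g i)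
    (hgx : x ≤ g 0 * g 0)
    (hTWx : ∀ P₁ P₁' P₂ P₂' : ℕ, (x : ℝ) ^ θ ≤ 2 * (P₁ : ℝ) → P₁ ≤ P₁' → P₁' ≤ 2 * P₁ → P₁ ≤ P₂ →
      P₂ ≤ P₂' → P₂' ≤ 2 * P₂ → ((P₁ * P₂ : ℕ) : ℝ) ≤ (x : ℝ) ^ (2 - μ) →
      ∀ h : ℤ, h ≠ 0 → |(h : ℝ)| ≤ ((P₁ * P₂ : ℕ) : ℝ) * (x : ℝ) ^ (ε₀ - 1) →
        ‖tS[h](P₁, P₁', P₂, P₂')‖ ≤ (x : ℝ) ^ (1 - ε₀))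
    {i j : ℕ} (hij : i ≤ j) (hgood : ((g (i + 1) * g (j + 1) : ℕ) : ℝ) ≤ (x : ℝ) ^ (2 - μ)) :
    |∑ q ∈ (Finset.Ioc (g i) (g (i + 1)) ×ˢ Finset.Ioc (g j) (g (j + 1))).filter
        (fun q : ℕ × ℕ => (q.1.Prime ∧ q.1 % 4 = 1) ∧ (q.2.Prime ∧ q.2 % 4 = 1)),
      (jacobiSym (q.1 : ℤ) q.2 : ℝ) *
        ((∑ t ∈ (Finset.Icc 1 x).filter (fun t : ℕ => q.1 * q.2 ∣ t ^ 2 + 1),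
            (((cutoffPoly[M, N, L, k]).coeff t : ℕ) : ℝ) / (L : ℝ) ^ k) -
          4 * (∑ t ∈ Finset.Icc 1 x, (((cutoffPoly[M, N, L, k]).coeff t : ℕ) : ℝ) / (L : ℝ) ^ k) /
            ((q.1 * q.2 : ℕ) : ℝ))| ≤
      48672 * (x : ℝ) ^ (1 - ε₀ + 3 * (ε₀ / 8)) +
        4 * (x : ℝ) ^ (2 - μ) * ((x : ℝ) ^ (1 - ε₀ / 8)) ^ (k + 1) / (L : ℝ) ^ k := by
  -- the cell
  set a := g i with ha_def
  set a' := g (i + 1) with ha'_def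
  set b := g j with hb_def
  set b' := g (j + 1) with hb'_def
  set ε₁ : ℝ := ε₀ / 8 with hε₁
  set X : ℝ := (x : ℝ) ^ (2 - μ) with hX
  have hxR : (0 : ℝ) < x := by exact_mod_cast hx0
  have hxR1 : (1 : ℝ) ≤ x := by exact_mod_cast hx0
  have hg0pos : 1 ≤ g 0 := by
    rcases Nat.eq_zero_or_pos (g 0) with h | h
    · rw [h] at hgx; omega
    · exact h
  have ha : 1 ≤ a := hg0pos.trans (hg (Nat.zero_le i))
  have hb : 1 ≤ b := hg0pos.trans (hg (Nat.zero_le j))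
  have haa' : a ≤ a' := hg (Nat.le_succ i)
  have hbb' : b ≤ b' := hg (Nat.le_succ j)
  have ha2 : a' ≤ 2 * a := hg2 i
  have hb2 : b' ≤ 2 * b := hg2 j
  have hab : a ≤ b := hg hij
  have habN : x ≤ a * b := hgx.trans (Nat.mul_le_mul (hg (Nat.zero_le i)) (hg (Nat.zero_le j)))
  have habR : (x : ℝ) ≤ (a : ℝ) * b := by exact_mod_cast habN
  have hab0 : (0 : ℝ) < (a : ℝ) * b := by positivity
  have habX : ((a * b : ℕ) : ℝ) ≤ X := le_trans (by exact_mod_cast Nat.mul_le_mul haa' hbb') hgood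
  -- powers of `x`
  have hxε₁ : 1 ≤ (x : ℝ) ^ ε₁ := Real.one_le_rpow hxR1 (by positivity)
  have hsplit1 : (x : ℝ) * (x : ℝ) ^ (ε₁ - 1) = (x : ℝ) ^ ε₁ := mul_rpow_sub_one hxR ε₁
  have hinv1 : (x : ℝ) ^ (ε₁ - 1) = ((x : ℝ) ^ (1 - ε₁))⁻¹ := by
    rw [← Real.rpow_neg hxR.le, neg_sub]
  have hx1' : (x : ℝ) ^ (ε₁ - 1) ≤ 1 / 16 := by
    rw [hinv1, hε₁, inv_eq_one_div]
    exact one_div_le_one_div_of_le (by norm_num) hx1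
  have hsplit2 : (x : ℝ) ^ (ε₀ - 1) = (x : ℝ) ^ (ε₀ - ε₁) * (x : ℝ) ^ (ε₁ - 1) := by
    rw [← Real.rpow_add hxR]; ring_nf
  -- the frequency cutoff
  set Hr : ℝ := 4 * ((a : ℝ) * b) * (x : ℝ) ^ (ε₁ - 1) with hHr
  set H : ℕ := ⌊Hr⌋₊ with hH_def
  have hHr0 : 0 ≤ Hr := by positivity
  have hHr4 : 4 * (x : ℝ) ^ ε₁ ≤ Hr := by
    rw [hHr, ← hsplit1]
    nlinarith [Real.rpow_nonneg hxR.le (ε₁ - 1)]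
  have hHle : (H : ℝ) ≤ Hr := Nat.floor_le hHr0
  have hHge : Hr ≤ 2 * (H : ℝ) := by
    have := Nat.lt_floor_add_one Hr
    rw [← hH_def] at this
    linarith
  have hH1 : 1 ≤ H := Nat.le_floor (by push_cast; linarith)
  have hH0 : (0 : ℝ) < H := by exact_mod_cast hH1
  have h2H : 2 * (H : ℝ) ≤ 8 * ((a : ℝ) * b) * (x : ℝ) ^ (ε₁ - 1) := by rw [hHr] at hHle; linarith
  have hHab : 2 * H < a * b := by
    have : 2 * (H : ℝ) < (a : ℝ) * b := by
      calc 2 * (H : ℝ) ≤ 8 * ((a : ℝ) * b) * (x : ℝ) ^ (ε₁ - 1) := h2H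
        _ ≤ 8 * ((a : ℝ) * b) * (1 / 16) := mul_le_mul_of_nonneg_left hx1' (by positivity)
        _ < (a : ℝ) * b := by linarith
    exact_mod_cast this
  -- the tier Weyl bound for this cell
  have hθa : (x : ℝ) ^ θ ≤ 2 * (a : ℝ) := by
    have h1 : (g 0 : ℝ) ≤ a := by exact_mod_cast hg (Nat.zero_le i)
    have h2 : (x : ℝ) ^ θ < (g 0 : ℝ) + 1 := by rw [hg0]; exact Nat.lt_floor_add_one _
    linarith
  have hX0 : 0 ≤ X := by rw [hX]; positivity
  clear_value H Hr a a' b b' ε₁ X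
  have hTW : ∀ h : ℤ, h ≠ 0 → |h| ≤ H → ∀ m ∈ Finset.Icc a a', ∀ n ∈ Finset.Icc b b',
      ‖tS[h](a, m, b, n)‖ ≤ (x : ℝ) ^ (1 - ε₀) := by
    intro h hh0 hhH m hm n hn
    rw [Finset.mem_Icc] at hm hn
    refine hTWx a m b n hθa hm.1 (hm.2.trans ha2) hab hn.1 (hn.2.trans hb2) habX h hh0 ?_
    have hhR : |(h : ℝ)| ≤ H := by
      rw [← Int.cast_abs]; exact_mod_cast hhH
    refine hhR.trans (hHle.trans ?_)
    rw [hHr, hsplit2]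
    push_cast
    have : 4 * (x : ℝ) ^ (ε₁ - 1) ≤ (x : ℝ) ^ (ε₀ - ε₁) * (x : ℝ) ^ (ε₁ - 1) :=
      mul_le_mul_of_nonneg_right hx2 (Real.rpow_nonneg hxR.le _)
    nlinarith
  -- the cell bound
  have hcell := cell_bound x M N L k hL hxw a a' b b' H ha haa' ha2 hb hbb' hb2 hH1 hHab
    ((x : ℝ) ^ (1 - ε₀)) hTW
  refine hcell.trans (add_le_add ?_ ?_)
  · -- the main term
    obtain ⟨-, -, hWx⟩ := sum_cutoff_weight_le M N L k x hL
    set W := ∑ t ∈ Finset.Icc 1 x, (((cutoffPoly[M, N, L, k]).coeff t : ℕ) : ℝ) / (L : ℝ) ^ k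
      with hW
    have hW0 : 0 ≤ W := Finset.sum_nonneg fun t _ => by positivity
    clear_value W
    have hY : 1 + 3 * Real.pi * ((H : ℝ) * x) / ((a : ℝ) * b) ≤ 39 * (x : ℝ) ^ ε₁ := by
      have h1 : (H : ℝ) * x / ((a : ℝ) * b) ≤ 4 * (x : ℝ) ^ ε₁ := by
        rw [div_le_iff₀ hab0]
        calc (H : ℝ) * x ≤ Hr * x := mul_le_mul_of_nonneg_right hHle hxR.le
          _ = 4 * (x : ℝ) ^ ε₁ * ((a : ℝ) * b) := by rw [hHr, ← hsplit1]; ring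
      have hπ := Real.pi_lt_d2
      rw [mul_div_assoc]
      nlinarith [Real.pi_pos]
    have hY0 : 0 ≤ 1 + 3 * Real.pi * ((H : ℝ) * x) / ((a : ℝ) * b) := by positivity
    have hBd0 : 0 ≤ (x : ℝ) ^ (1 - ε₀) := Real.rpow_nonneg hxR.le _
    calc 2 * (H : ℝ) * (x : ℝ) ^ (1 - ε₀) *
          (4 * W * (1 + 3 * Real.pi * ((H : ℝ) * x) / ((a : ℝ) * b)) ^ 2 / ((a : ℝ) * b))
        ≤ (8 * ((a : ℝ) * b) * (x : ℝ) ^ (ε₁ - 1)) * (x : ℝ) ^ (1 - ε₀) *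
          (4 * x * (39 * (x : ℝ) ^ ε₁) ^ 2 / ((a : ℝ) * b)) := by
          refine mul_le_mul (mul_le_mul_of_nonneg_right h2H hBd0) ?_ (by positivity) (by positivity)
          refine div_le_div_of_nonneg_right ?_ hab0.le
          exact mul_le_mul (mul_le_mul_of_nonneg_left hWx (by norm_num))
            (pow_le_pow_left₀ hY0 hY 2) (by positivity) (by positivity)
      _ = 48672 * (((x : ℝ) * (x : ℝ) ^ (ε₁ - 1)) * (x : ℝ) ^ (1 - ε₀) *
          ((x : ℝ) ^ ε₁ * (x : ℝ) ^ ε₁)) := by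
          field_simp
          ring
      _ = 48672 * (x : ℝ) ^ (1 - ε₀ + 3 * ε₁) := by
          rw [hsplit1, ← Real.rpow_add hxR, ← Real.rpow_add hxR, ← Real.rpow_add hxR]
          ring_nf
  · -- the tail term
    have hcard : ((((Finset.Ioc a a' ×ˢ Finset.Ioc b b').filter
        (fun q : ℕ × ℕ => (q.1.Prime ∧ q.1 % 4 = 1) ∧ (q.2.Prime ∧ q.2 % 4 = 1))).card : ℕ) : ℝ) ≤
        X := by
      have h1 := Finset.card_filter_le (Finset.Ioc a a' ×ˢ Finset.Ioc b b')
        (fun q : ℕ × ℕ => (q.1.Prime ∧ q.1 % 4 = 1) ∧ (q.2.Prime ∧ q.2 % 4 = 1))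
      rw [Finset.card_product, Nat.card_Ioc, Nat.card_Ioc] at h1
      have h2 : (a' - a) * (b' - b) ≤ a' * b' := Nat.mul_le_mul (Nat.sub_le _ _) (Nat.sub_le _ _)
      exact le_trans (by exact_mod_cast h1.trans h2) hgood
    have hratio : ((a' : ℝ) * b') / (2 * H) ≤ (x : ℝ) ^ (1 - ε₁) := by
      have h2H' : 4 * ((a : ℝ) * b) * (x : ℝ) ^ (ε₁ - 1) ≤ 2 * (H : ℝ) := by rw [hHr] at hHge; exact hHge
      have hpos : 0 < 4 * ((a : ℝ) * b) * (x : ℝ) ^ (ε₁ - 1) := by positivity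
      have hab4 : (a' : ℝ) * b' ≤ 4 * ((a : ℝ) * b) := by
        have : a' * b' ≤ 2 * a * (2 * b) := Nat.mul_le_mul ha2 hb2
        have : ((a' * b' : ℕ) : ℝ) ≤ ((2 * a * (2 * b) : ℕ) : ℝ) := by exact_mod_cast this
        push_cast at this
        linarith
      calc ((a' : ℝ) * b') / (2 * H) ≤ (4 * ((a : ℝ) * b)) / (4 * ((a : ℝ) * b) * (x : ℝ) ^ (ε₁ - 1)) :=
            div_le_div₀ (by positivity) hab4 hpos h2H'
        _ = ((x : ℝ) ^ (ε₁ - 1))⁻¹ := by field_simp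
        _ = (x : ℝ) ^ (1 - ε₁) := by rw [hinv1, inv_inv]
    have hratio0 : 0 ≤ ((a' : ℝ) * b') / (2 * H) := by positivity
    have hc2 : 4 * (((a' : ℝ) * b') / (2 * H)) ^ (k + 1) / (L : ℝ) ^ k ≤
        4 * ((x : ℝ) ^ (1 - ε₁)) ^ (k + 1) / (L : ℝ) ^ k :=
      div_le_div_of_nonneg_right (mul_le_mul_of_nonneg_left
        (pow_le_pow_left₀ hratio0 hratio (k + 1)) (by norm_num)) (by positivity)
    have hc20 : 0 ≤ 4 * (((a' : ℝ) * b') / (2 * H)) ^ (k + 1) / (L : ℝ) ^ k := by positivity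
    calc _ ≤ X * (4 * ((x : ℝ) ^ (1 - ε₁)) ^ (k + 1) / (L : ℝ) ^ k) :=
          mul_le_mul hcard hc2 hc20 hX0
      _ = 4 * X * ((x : ℝ) ^ (1 - ε₁)) ^ (k + 1) / (L : ℝ) ^ k := by ring

end Summit.Parity.BatemanHorn.Cruxes.SplitBlockJacobi.CofactorRootDiscrepancy.Poisson

namespace Summit.Parity.BatemanHorn.Cruxes.SplitBlockJacobi.CofactorRootDiscrepancy

/-- **Registered stub form** of `Poisson.good_cell_bound`: the identical statement, declared in the crux
namespace under the name registered on stmt-Parity-11583 (`ledger workitem stub-add`). -/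
theorem good_cell_bound :
    ∀ (θ μ ε₀ : ℝ) (x M N L k : ℕ) (hε₀ : 0 < ε₀) (hL : 0 < L) (hxw : N + k * (L - 1) ≤ x) (hx0 : 1 ≤ x) (hx1 : (16 : ℝ) ≤ (x : ℝ) ^ (1 - ε₀ / 8)) (hx2 : (4 : ℝ) ≤ (x : ℝ) ^ (ε₀ - ε₀ / 8)) (hxθ : (2 : ℝ) ≤ (x : ℝ) ^ θ) {g : ℕ → ℕ} (hg : Monotone g) (hg0 : g 0 = ⌊(x : ℝ) ^ θ⌋₊) (hg2 : ∀ i, g (i + 1) ≤ 2 * g i) (hgx : x ≤ g 0 * g 0) (hTWx : ∀ P₁ P₁' P₂ P₂' : ℕ, (x : ℝ) ^ θ ≤ 2 * (P₁ : ℝ) → P₁ ≤ P₁' → P₁' ≤ 2 * P₁ → P₁ ≤ P₂ → P₂ ≤ P₂' → P₂' ≤ 2 * P₂ → ((P₁ * P₂ : ℕ) : ℝ) ≤ (x : ℝ) ^ (2 - μ) → ∀ h : ℤ, h ≠ 0 → |(h : ℝ)| ≤ ((P₁ * P₂ : ℕ) : ℝ) * (x : ℝ) ^ (ε₀ - 1)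 → ‖(∑ Q ∈ (Finset.Ioc (P₁ : ℕ) P₁').filter (fun Q : ℕ => Q.Prime ∧ Q % 4 = 1), ∑ Q' ∈ (Finset.Ioc (P₂ : ℕ) P₂').filter (fun Q' : ℕ => Q'.Prime ∧ Q' % 4 = 1), ((jacobiSym (Q : ℤ) Q' : ℤ) : ℂ) * (∑ ν ∈ (Finset.range (Q * Q' : ℕ)).filter (fun ν : ℕ => (Q * Q' : ℕ) ∣ ν ^ 2 + 1), Complex.exp (2 * Real.pi * Complex.I * ((h : ℤ) : ℂ) * ((ν : ℕ) : ℂ) / ((Q * Q' : ℕ) : ℂ))))‖ ≤ (x : ℝ) ^ (1 - ε₀)) {i j : ℕ} (hij : i ≤ j) (hgood : ((g (i + 1) * g (j + 1) : ℕ) : ℝ) ≤ (x : ℝ) ^ (2 - μ)), |∑ q ∈ (Finset.Ioc (g i) (g (i + 1)) ×ˢ Finset.Ioc (g j) (g (j + 1))).filter (fun q : ℕ × ℕ => (q.1.Prime ∧ q.1 % 4 = 1) ∧ (q.2.Prime ∧ q.2 % 4 = 1)), (jacobiSym (q.1 : ℤ) q.2 : ℝ) * ((∑ t ∈ (Finset.Icc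 1 x).filter (fun t : ℕ => q.1 * q.2 ∣ t ^ 2 + 1), (((((∑ s ∈ Finset.Ioc M N, (Polynomial.X : Polynomial ℕ) ^ s) * (∑ j ∈ Finset.range L, (Polynomial.X : Polynomial ℕ) ^ j) ^ k)).coeff t : ℕ) : ℝ) / (L : ℝ) ^ k) - 4 * (∑ t ∈ Finset.Icc 1 x, (((((∑ s ∈ Finset.Ioc M N, (Polynomial.X : Polynomial ℕ) ^ s) * (∑ j ∈ Finset.range L, (Polynomial.X : Polynomial ℕ) ^ j) ^ k)).coeff t : ℕ) : ℝ) / (L : ℝ) ^ k) / ((q.1 * q.2 : ℕ) : ℝ))| ≤ 48672 * (x : ℝ) ^ (1 - ε₀ + 3 * (ε₀ / 8)) + 4 * (x : ℝ) ^ (2 - μ) * ((x : ℝ) ^ (1 - ε₀ / 8)) ^ (k + 1) / (L : ℝ) ^ k :=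
  @Poisson.good_cell_bound

end Summit.Parity.BatemanHorn.Cruxes.SplitBlockJacobi.CofactorRootDiscrepancy

end
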